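import Mathlib
import HarnessLib
import Summits.Ventures.LatticeQCDFlow.Exactness.NCMCGeneralSpaceEventTauIntPositive
import Summits.Ventures.LatticeQCDFlow.Exactness.NCMCGeneralSpaceOccupancyChainGammaCoverage
import Summits.Ventures.LatticeQCDFlow.Exactness.NCMCGeneralSpaceOccupancyChainDoeblin
import Summits.Ventures.LatticeQCDFlow.Exactness.NCMCGeneralSpaceOccupancyChainMeans

/-!
# Lemmas for the NCMC lane's `τ_int` floor: an elementary double-integral inequality, the prior level of `π_c`, and the rejected branch of the conditional variance

HONEST FRAMING: exact (Metropolis-corrected) sampling algorithms for lattice gauge theory;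
figures of merit are autocorrelation/cost numbers at stated couplings and volumes; no
continuum-physics claim.

Venture `LatticeQCDFlow` (cell pub-lqcd), topic `Exactness`; FANOUT row 13 (`eng-snf`, GEN-21).
NEW WORK of the cell, not a published result; no definition is introduced; nothing is cited as a
fact.  Preparatory file for `NCMCGeneralSpaceOccupancyTauIntLowerBound` (the explicit floor
`τ_int(ρ_occ) ≥ σ ρ₀² / (2 (1 + ρ₀))`); setting of GEN-18's two-step certificate
(`NCMCGeneralSpaceOccupancyChainDoeblin`): iteration kernel
`Q = switchKernel κF κR c W s e ∘ₖ levelKernel T₀ T₁` on `Bool × Ω`, level samplers with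
`m₀ ≤ T₀(x, ·)` for all `x`, rejected-mass measure `(1 − F_c(·, Ω)) m₀`.

## Content

* §1 `sq_shift_aux`, `integral_sq_shift_expand`, **`sq_mul_sq_le_integral_integral_sq_shift`** —
  for a probability law `P`, a finite measure `A ≤ P` (`ρ = A.real univ`), `u` bounded measurable and
  any real `t`: `ρ² t² ≤ (1 + ρ) ∫_P ∫_A (u(x') − u(x) − t)² dA(x') dP(x)` (with `b` the `P`-mean of
  `u` and `V = Var_P u` the double integral is `∫_A (u − b − t)² + ρ V`, and
  `(1 + ρ) ∫_A (u − b − t)² ≥ ρ² t² − ρ (1 + ρ) ∫_A (u − b)² ≥ ρ² t² − ρ (1 + ρ) V`).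
* §2 `smul_le_of_minorised_invariant` (`ν₀(Ω) • m₀ ≤ ν₀` from `m₀ ≤ T₀(x, ·)` and invariance),
  `le_normalised_of_minorised_invariant` (`m₀ ≤ ν₀(Ω)⁻¹ • ν₀`), `withDensity_rej_le`
  (`(1 − F_c) m₀ ≤ m₀`), `withDensity_rej_univ` (its mass is `ρ₀ = ∫⁻ (1 − F_c) dm₀`),
  `integral_jointLaw_ge_prior` (`Z⁻¹ ∫ g(prior, x) dν₀ ≤ ∫ g dπ_c` for `g ≥ 0`),
  **`integral_rejected_sq_le`** (for `m₀ ≤ T₀(x, ·)`: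
  `∫ (H(prior, x') − a)² d((1 − F_c) m₀) ≤ ∫ (H − a)² dQ((prior, x), ·)` — GEN-18's
  `rejPrior_le_iteration` read on a squared deviation).

NOT CLAIMED: anything numerical.
-/

namespace Summit.Ventures.LatticeQCDFlow.Exactness.GeneralNCMC

open MeasureTheory ProbabilityTheory Set Filter Finset
open scoped ENNReal NNReal Topology

/-! ## §1 An elementary double-integral inequality -/

section Analytic

variable {α : Type*} [MeasurableSpace α]

/-- `ρ t² − ρ (1 + ρ) d² ≤ (1 + ρ) (d − t)²` (a complete square). -/
theorem sq_shift_aux (ρ d t : ℝ) : ρ * t ^ 2 - ρ * (1 + ρ) * d ^ 2 ≤ (1 + ρ) * (d - t) ^ 2 := by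
  nlinarith [sq_nonneg ((1 + ρ) * d - t)]

/-- Expansion of the inner integral: with `b = ∫ u dP`, `J = ∫_A (u − t − b)²`, `B = ∫_A (u − t − b)`,
`∫_A (u(x') − u(x) − t)² = J − 2 (u(x) − b) B + ρ (u(x) − b)²`. -/
theorem integral_sq_shift_expand (A : Measure α) [IsFiniteMeasure A] {u : α → ℝ} (hum : Measurable u)
    {Cu : ℝ} (hub : ∀ x, |u x| ≤ Cu) (t b : ℝ) (x : α) :
    ∫ x', (u x' - u x - t) ^ 2 ∂A
      = (∫ x', (u x' - t - b) ^ 2 ∂A) - 2 * (u x - b) * (∫ x', (u x' - t - b) ∂A)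
        + A.real univ * (u x - b) ^ 2 := by
  have hi1 : Integrable (fun x' => (u x' - t - b) ^ 2) A :=
    Scoring.integrable_of_bounded A ((hum.sub_const _).sub_const _ |>.pow_const 2)
      (C := (Cu + |t| + |b|) ^ 2) fun x' => by
        rw [abs_pow]
        refine pow_le_pow_left₀ (abs_nonneg _) ?_ 2
        calc |u x' - t - b| ≤ |u x' - t| + |b| := abs_sub _ _
          _ ≤ |u x'| + |t| + |b| := by linarith [abs_sub (u x') t]
          _ ≤ Cu + |t| + |b| := by linarith [hub x']
  have hi2 : Integrable (fun x' => u x' - t - b) A :=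
    Scoring.integrable_of_bounded A ((hum.sub_const _).sub_const _) (C := Cu + |t| + |b|) fun x' => by
      calc |u x' - t - b| ≤ |u x' - t| + |b| := abs_sub _ _
        _ ≤ |u x'| + |t| + |b| := by linarith [abs_sub (u x') t]
        _ ≤ Cu + |t| + |b| := by linarith [hub x']
  have hi2' : Integrable (fun x' => 2 * (u x - b) * (u x' - t - b)) A := hi2.const_mul _
  have hi3 : Integrable (fun x' => (u x' - t - b) ^ 2 - 2 * (u x - b) * (u x' - t - b)) A :=
    hi1.sub hi2'
  have hexp : (fun x' => (u x' - u x - t) ^ 2)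
      = fun x' => ((u x' - t - b) ^ 2 - 2 * (u x - b) * (u x' - t - b)) + (u x - b) ^ 2 := by
    funext x'; ring
  rw [hexp, integral_add hi3 (integrable_const _), integral_sub hi1 hi2', integral_const_mul,
    integral_const, smul_eq_mul]

/-- **The double-integral inequality.**  `P` a probability law, `A ≤ P` a finite measure with
`ρ = A.real univ`, `u` bounded measurable, `t` real:
`ρ² t² ≤ (1 + ρ) ∫_P ∫_A (u(x') − u(x) − t)² dA(x') dP(x)`.  (With `b = P`-mean of `u` and
`V = Var_P u`: the double integral is `∫_A (u − b − t)² + ρ V`, while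
`(1 + ρ) ∫_A (u − b − t)² ≥ ρ² t² − ρ (1 + ρ) ∫_A (u − b)² ≥ ρ² t² − ρ (1 + ρ) V`.) -/
theorem sq_mul_sq_le_integral_integral_sq_shift (P : Measure α) [IsProbabilityMeasure P]
    (A : Measure α) [IsFiniteMeasure A] (hAP : A ≤ P) {u : α → ℝ} (hum : Measurable u) {Cu : ℝ}
    (hub : ∀ x, |u x| ≤ Cu) (t : ℝ) :
    A.real univ ^ 2 * t ^ 2 ≤ (1 + A.real univ) * ∫ x, ∫ x', (u x' - u x - t) ^ 2 ∂A ∂P := by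
  set ρ := A.real univ with hρ
  have hρ0 : 0 ≤ ρ := measureReal_nonneg
  set b := ∫ x, u x ∂P with hb
  -- integrability
  have hbd : ∀ x', |u x' - t - b| ≤ Cu + |t| + |b| := fun x' =>
    calc |u x' - t - b| ≤ |u x' - t| + |b| := abs_sub _ _
      _ ≤ |u x'| + |t| + |b| := by linarith [abs_sub (u x') t]
      _ ≤ Cu + |t| + |b| := by linarith [hub x']
  have hm1 : Measurable fun x' => u x' - t - b := (hum.sub_const _).sub_const _
  have hiA1 : Integrable (fun x' => u x' - t - b) A := Scoring.integrable_of_bounded A hm1 hbd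
  have hiA2 : Integrable (fun x' => (u x' - t - b) ^ 2) A :=
    Scoring.integrable_of_bounded A (hm1.pow_const 2) (C := (Cu + |t| + |b|) ^ 2) fun x' => by
      rw [abs_pow]; exact pow_le_pow_left₀ (abs_nonneg _) (hbd x') 2
  have hbd' : ∀ x, |u x - b| ≤ Cu + |b| := fun x => (abs_sub _ _).trans (by linarith [hub x])
  have hm2 : Measurable fun x => u x - b := hum.sub_const _
  have hiP1 : Integrable (fun x => u x - b) P := Scoring.integrable_of_bounded P hm2 hbd'
  have hiP2 : Integrable (fun x => (u x - b) ^ 2) P :=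
    Scoring.integrable_of_bounded P (hm2.pow_const 2) (C := (Cu + |b|) ^ 2) fun x => by
      rw [abs_pow]; exact pow_le_pow_left₀ (abs_nonneg _) (hbd' x) 2
  have hiA3 : Integrable (fun x => (u x - b) ^ 2) A :=
    Scoring.integrable_of_bounded A (hm2.pow_const 2) (C := (Cu + |b|) ^ 2) fun x => by
      rw [abs_pow]; exact pow_le_pow_left₀ (abs_nonneg _) (hbd' x) 2
  -- abbreviations
  set J := ∫ x', (u x' - t - b) ^ 2 ∂A with hJ
  set B := ∫ x', (u x' - t - b) ∂A with hB
  set V := ∫ x, (u x - b) ^ 2 ∂P with hV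
  set VA := ∫ x, (u x - b) ^ 2 ∂A with hVA
  -- the double integral equals `J + ρ V` (the cross term has `P`-mean zero)
  have hmean0 : ∫ x, (u x - b) ∂P = 0 := by
    rw [integral_sub (Scoring.integrable_of_bounded P hum hub) (integrable_const _), integral_const,
      probReal_univ, one_smul, hb, sub_self]
  have hdouble : ∫ x, ∫ x', (u x' - u x - t) ^ 2 ∂A ∂P = J + ρ * V := by
    have hpt : ∀ x, ∫ x', (u x' - u x - t) ^ 2 ∂A = (J - 2 * B * (u x - b)) + ρ * (u x - b) ^ 2 := by
      intro x
      rw [integral_sq_shift_expand A hum hub t b x]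
      ring
    simp_rw [hpt]
    have hi1 : Integrable (fun x => 2 * B * (u x - b)) P := hiP1.const_mul _
    have hi2 : Integrable (fun x => J - 2 * B * (u x - b)) P := (integrable_const J).sub hi1
    have hi3 : Integrable (fun x => ρ * (u x - b) ^ 2) P := hiP2.const_mul _
    rw [integral_add hi2 hi3, integral_sub (integrable_const J) hi1, integral_const_mul,
      integral_const_mul, integral_const, probReal_univ, one_smul, hmean0, mul_zero, sub_zero]
  -- `VA ≤ V` (since `A ≤ P`)
  have hVAV : VA ≤ V := integral_mono_measure hAP (ae_of_all _ fun x => sq_nonneg _) hiP2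
  -- `(1 + ρ) J ≥ ρ² t² − ρ (1 + ρ) VA`
  have hJ_ge : ρ * t ^ 2 * ρ - ρ * (1 + ρ) * VA ≤ (1 + ρ) * J := by
    have hpt : ∀ x', ρ * t ^ 2 - ρ * (1 + ρ) * (u x' - b) ^ 2 ≤ (1 + ρ) * (u x' - t - b) ^ 2 :=
      fun x' => by
        have := sq_shift_aux ρ (u x' - b) t
        calc ρ * t ^ 2 - ρ * (1 + ρ) * (u x' - b) ^ 2 ≤ (1 + ρ) * (u x' - b - t) ^ 2 := this
          _ = (1 + ρ) * (u x' - t - b) ^ 2 := by ring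
    have hi1 : Integrable (fun x' => ρ * (1 + ρ) * (u x' - b) ^ 2) A := hiA3.const_mul _
    have hi2 : Integrable (fun x' => ρ * t ^ 2 - ρ * (1 + ρ) * (u x' - b) ^ 2) A :=
      (integrable_const _).sub hi1
    have hi3 : Integrable (fun x' => (1 + ρ) * (u x' - t - b) ^ 2) A := hiA2.const_mul _
    have hint := integral_mono hi2 hi3 hpt
    rw [integral_sub (integrable_const _) hi1, integral_const, smul_eq_mul, integral_const_mul,
      integral_const_mul] at hint
    linarith
  rw [hdouble]
  nlinarith [mul_nonneg (mul_nonneg hρ0 (by linarith : (0 : ℝ) ≤ 1 + ρ)) (sub_nonneg.2 hVAV)]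

end Analytic

/-! ## §2 Lane bookkeeping: the prior level and the rejected branch -/

section Lane

variable {Ω E : Type*} [MeasurableSpace Ω] [MeasurableSpace E]

/-- **Uniform minorisation + invariance**: if `m₀ ≤ T₀(x, ·)` for every `x` and `ν₀` is
`T₀`-invariant then `ν₀(Ω) • m₀ ≤ ν₀`. -/
theorem smul_le_of_minorised_invariant {T₀ : Kernel Ω Ω} {ν₀ m₀ : Measure Ω}
    (hT₀ : Kernel.Invariant T₀ ν₀) (hmin₀ : ∀ x, m₀ ≤ T₀ x) : ν₀ univ • m₀ ≤ ν₀ := by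
  refine Measure.le_iff.2 fun B hB => ?_
  rw [Measure.smul_apply, smul_eq_mul]
  calc ν₀ univ * m₀ B = ∫⁻ _, m₀ B ∂ν₀ := by rw [lintegral_const, mul_comm]
    _ ≤ ∫⁻ x, T₀ x B ∂ν₀ := lintegral_mono fun x => Measure.le_iff'.1 (hmin₀ x) B
    _ = (ν₀.bind T₀) B := (Measure.bind_apply hB (Kernel.aemeasurable _)).symm
    _ = ν₀ B := by rw [hT₀.def]

/-- Hence `m₀ ≤ ν₀(Ω)⁻¹ • ν₀ = π₀`, the normalised prior law (`0 < ν₀(Ω) < ∞`). -/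
theorem le_normalised_of_minorised_invariant {T₀ : Kernel Ω Ω} {ν₀ m₀ : Measure Ω}
    [IsFiniteMeasure ν₀] (h0 : ν₀ univ ≠ 0) (hT₀ : Kernel.Invariant T₀ ν₀)
    (hmin₀ : ∀ x, m₀ ≤ T₀ x) : m₀ ≤ (ν₀ univ)⁻¹ • ν₀ := by
  have h := smul_le_of_minorised_invariant hT₀ hmin₀
  refine Measure.le_iff.2 fun B hB => ?_
  have hB' := Measure.le_iff.1 h B hB
  rw [Measure.smul_apply, smul_eq_mul] at hB' ⊢
  calc m₀ B = (ν₀ univ)⁻¹ * (ν₀ univ * m₀ B) := by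
        rw [← mul_assoc, ENNReal.inv_mul_cancel h0 (measure_ne_top _ _), one_mul]
    _ ≤ (ν₀ univ)⁻¹ * ν₀ B := mul_le_mul' le_rfl hB'

variable {κF κR : Kernel Ω E} [IsMarkovKernel κF] [IsMarkovKernel κR] {c : ℝ} {W : E → ℝ}
  {s e : E → Ω}

omit [IsMarkovKernel κF] in
/-- The rejected-mass measure `(1 − F_c) m₀` lies below `m₀`. -/
theorem withDensity_rej_le (m₀ : Measure Ω) :
    (m₀.withDensity fun x' => 1 - fwdFlow κF c W e x' univ) ≤ m₀ := by
  have h1 : (fun x' => 1 - fwdFlow κF c W e x' univ) ≤ᵐ[m₀] fun _ => (1 : ℝ≥0∞) :=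
    ae_of_all _ fun x' => by
      show 1 - fwdFlow κF c W e x' univ ≤ 1
      exact tsub_le_self
  calc (m₀.withDensity fun x' => 1 - fwdFlow κF c W e x' univ) ≤ m₀.withDensity fun _ => 1 :=
        withDensity_mono h1
    _ = m₀ := withDensity_one

omit [IsMarkovKernel κF] in
/-- Its total mass is the rejected forward mass `ρ₀ = ∫ (1 − F_c(x', Ω)) dm₀`. -/
theorem withDensity_rej_univ (m₀ : Measure Ω) :
    (m₀.withDensity fun x' => 1 - fwdFlow κF c W e x' univ) univ
      = ∫⁻ x', (1 - fwdFlow κF c W e x' univ) ∂m₀ := by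
  rw [withDensity_apply _ MeasurableSet.univ, Measure.restrict_univ]

/-- **Restriction to the prior level**: for `g ≥ 0` bounded measurable,
`Z⁻¹ ∫ g(prior, x) dν₀ ≤ ∫ g dπ_c` (`Z = Π_c(everything)`). -/
theorem integral_jointLaw_ge_prior (c : ℝ) (ν₀ ν₁ : Measure Ω) [IsFiniteMeasure ν₀]
    [IsFiniteMeasure ν₁] {g : Bool × Ω → ℝ} (hg : Measurable g) (hg0 : ∀ z, 0 ≤ g z) {Cg : ℝ}
    (hgb : ∀ z, |g z| ≤ Cg) :
    ((jointWeight c ν₀ ν₁ univ).toReal)⁻¹ * ∫ x, g (false, x) ∂ν₀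
      ≤ ∫ z, g z ∂((jointWeight c ν₀ ν₁ univ)⁻¹ • jointWeight c ν₀ ν₁) := by
  rw [integral_jointLaw, integral_jointWeight_real c ν₀ ν₁ hg
    (Scoring.integrable_of_bounded ν₀ (hg.comp measurable_prodMk_left) fun x => hgb _)
    (Scoring.integrable_of_bounded ν₁ (hg.comp measurable_prodMk_left) fun y => hgb _)]
  have h2 : 0 ≤ Real.exp c * ∫ y, g (true, y) ∂ν₁ :=
    mul_nonneg (Real.exp_pos c).le (integral_nonneg fun y => hg0 _)
  exact mul_le_mul_of_nonneg_left (le_add_of_nonneg_right h2) (inv_nonneg.2 ENNReal.toReal_nonneg)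

variable (T₀ T₁ : Kernel Ω Ω) [IsMarkovKernel T₀] [IsMarkovKernel T₁]

/-- **The rejected branch of the conditional variance at a prior state.**  If `m₀ ≤ T₀(x, ·)`, then
for every bounded measurable `H` on `Bool × Ω` and every real `a`:
`∫ (H(prior, x') − a)² d((1 − F_c) m₀)(x') ≤ ∫ (H(z) − a)² dQ((prior, x), dz)`
(`Q = switchKernel ∘ₖ levelKernel T₀ T₁`; GEN-18's `rejPrior_le_iteration`). -/
theorem integral_rejected_sq_le (hW : Measurable W) (hs : Measurable s) (he : Measurable e)
    {m₀ : Measure Ω} {x : Ω} (hmin : m₀ ≤ T₀ x) {H : Bool × Ω → ℝ} (hHm : Measurable H) {CH : ℝ}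
    (hHb : ∀ z, |H z| ≤ CH) (a : ℝ) :
    haveI := isMarkovKernel_switchKernel (κF := κF) (κR := κR) (c := c) hW hs he
    ∫ x', (H (false, x') - a) ^ 2 ∂(m₀.withDensity fun x' => 1 - fwdFlow κF c W e x' univ)
      ≤ ∫ z, (H z - a) ^ 2 ∂((switchKernel κF κR c W s e ∘ₖ levelKernel T₀ T₁) (false, x)) := by
  haveI := isMarkovKernel_switchKernel (κF := κF) (κR := κR) (c := c) hW hs he
  haveI := isMarkovKernel_levelKernel T₀ T₁
  have hle := rejPrior_le_iteration (κF := κF) (κR := κR) (c := c) (W := W) (s := s) (e := e)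
    T₀ T₁ hW he hmin
  have hfm : Measurable fun z : Bool × Ω => (H z - a) ^ 2 := (hHm.sub_const _).pow_const 2
  have hfb : ∀ z, |(H z - a) ^ 2| ≤ (CH + |a|) ^ 2 := fun z => by
    rw [abs_pow]
    have h1 : |H z - a| ≤ CH + |a| := (abs_sub (H z) a).trans (by linarith [hHb z])
    exact pow_le_pow_left₀ (abs_nonneg _) h1 2
  calc ∫ x', (H (false, x') - a) ^ 2 ∂(m₀.withDensity fun x' => 1 - fwdFlow κF c W e x' univ)
      = ∫ z, (H z - a) ^ 2
          ∂((m₀.withDensity fun x' => 1 - fwdFlow κF c W e x' univ).map (Prod.mk false)) := by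
        rw [integral_map measurable_prodMk_left.aemeasurable hfm.aestronglyMeasurable]
    _ ≤ ∫ z, (H z - a) ^ 2 ∂((switchKernel κF κR c W s e ∘ₖ levelKernel T₀ T₁) (false, x)) :=
        integral_mono_measure hle (ae_of_all _ fun _ => sq_nonneg _)
          (Scoring.integrable_of_bounded _ hfm hfb)

end Lane

end Summit.Ventures.LatticeQCDFlow.Exactness.GeneralNCMC
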